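/- Copyright: the b2b-balaban cell (near-miss cell 7), T⁴-continuum fan-out, lineage t4-ne7b-p1 (node U5c COUNT
member; row NE7b owner, M5-2 «the witness plug»).  Released under the licence of the surrounding project. -/
import Summits.QuantumFields.BalabanUV.T4Continuum.Support.B16HistoryInputFamily
import Summits.QuantumFields.BalabanUV.T4Continuum.Support.HistoryBankingForestPlug

/-!
# M5-2d — THE WEIGHT OF A TERM OF (1.72) IN THE END's CURRENCY: M2 brick B's bound with the volume factor split along the
pass-V forest — per LIVE member `e^{lifeCost (costT) (genT)} · e^{weighted class remainder} · (event product)`, per DEAD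
genealogy `e^{tree volume} · (event product)`, times the envelope (owner module of row NE7b, lineage `t4-ne7b-p1` gen 44;
re-open object (α), `SCOPE-alpha.md` v2.6, `ROW-NE7b-STATE.md` v1.23 §5 (2); M5-2 «the witness plug», END-facing form;
PRE-POSITIONING ONLY)

Summits-side support leaf of the T⁴-continuum cell (rung (B)+1 on a FINITE torus only; NOT infinite volume, NOT the
mass gap, NOT the Clay statement; NOT a proof of the spine estimate NE7b — the cell's OWN estimate, NOT PRINTED, NOT
PROVED).  [folklore] composition by name of leaf-04's M2 brick B (`B16HistoryInputFamily.weight_le_evProd_mk`: U1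
integrated, `HistRead`'s displayed identification), the pass-V bridges (`HistoryGenealogyJunctionV.evProd_pedMV_eq_pgenR`,
`HistoryGenealogyDissolveEvProd.prod_comp_dissolve_evProd` ∕ `prod_died_dissolve_evProd`,
`HistoryGenealogyPedigreeEvProd.evProd_pedM_eq_pgenR`) and M5-2b∕c on the pass-V objects
(`HistoryBankingForestPlug.prod_pow_card_le_live_mul_dead`); nothing printed is asserted, no `def`, no cite-tagged
hypothesis, zero `sorry`.  B16 = [Balaban1989LargeFieldII] pp. 378–387 under audit; locators only.

WHAT.  §1 the event products of the live and of the died components are UNCHANGED by the dissolution, pedigree form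
(`prod_comp_evProd_pedMV`, `prod_died_evProd_pedMV`: `pedM` ↦ `pedMV` over `histM.comp` ↦ `histV.comp`, `histM.died` ↦
`histV.died`).  §2 **`weight_le_live_mul_dead`**: under `HistRead`, the process conditions of the pass-V junction
(`NewOK`, `Rm ≤ R`, `Rm t (k+1) ≤ R (t+1)`, `2 ≤ Rm t 1`, `NewDisjoint`, `0 < L`), the banking side conditions (`4 ≤ L`,
drop control, `R ≥ 1`, `13 ≤ n₁`, `E₂, E₃ ≥ 0`) and the calibrated volume displays for `u = log ∘ Λ K`, for `K₀ ≤ K`,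
`|t| ≤ l₀` and a term `⟨K, a, (h, ℓ, c)⟩`:
`weight ≤ (∏_{c ∈ histV.comp K} e^{lifeCost (dictWT Prod.fst R C.n₁) (costT Prod.fst C K R) (pedMV.genT (K, c))} ·
e^{birthWT Prod.fst (2^{d+3} log Λ K) (pedMV.genT (K, c))} · evProd (fB K) (fR K) (pedMV.toPGen id (K, c))) ·
(∏_{j < K} ∏_{c ∈ histV.died j} e^{treeVol id pedMV (log Λ K) j (j, c)} · evProd (fB K) (fR K) (pedMV.toPGen id (j, c))) ·
rest` — the LIVE members priced in the END's booked-cost currency with `κ := costT` (what `priceM` at `costT` is to read,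
`HistoryRealiseCellsRunApexT3bWTV`), the DEAD genealogies and the envelope left to `dead`∕`resumM`∕`nup`.

WHAT IS *NOT* DONE HERE.  The credit reading (`evProd (fB K) (fR K)` of a live member against `e^{−pcredits}·e^{−Ξ}` and
the class remainder), the resummation of the dead factors over the fibres of equal physical live data, the END twin.
HONEST: bookkeeping; NE7b NOT proved; spine 0∕9.  HONEST DEPENDENCY (cell): continuum YM on T⁴ ⇐ BetaPertH ∧ nine
spine estimates (0∕9 proved); BetaPertH ⇐ (D1) ∧ (D4) ∧ CAP+tail.  This file changes none of it.
-/

open Finset MeasureTheory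
open Literature.MathematicalPhysics.QuantumFieldTheory.Balaban1983to89
open Literature.MathematicalPhysics.QuantumFieldTheory.Balaban1983to89.B13ScaleTransfer
open Literature.MathematicalPhysics.QuantumFieldTheory.Balaban1983to89.B16SProfile
open T4PersistenceDictionary T4PrintedShapeBanking T4TaggedShapeBanking T4BankedInduction
open Summit.QuantumFields.BalabanUV.T4Continuum.HistoryAdmissible
open Summit.QuantumFields.BalabanUV.T4Continuum.HistoryGen
open Summit.QuantumFields.BalabanUV.T4Continuum.HistoryGenealogyExtraction
open Summit.QuantumFields.BalabanUV.T4Continuum.HistoryGenealogyRealise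
open Summit.QuantumFields.BalabanUV.T4Continuum.HistoryGenealogyInstantiate
open Summit.QuantumFields.BalabanUV.T4Continuum.HistoryGenealogyPedigree
open Summit.QuantumFields.BalabanUV.T4Continuum.B16HistoryIndexedRepr
open Summit.QuantumFields.BalabanUV.T4Continuum.HistoryBankingForestVolume
open Summit.QuantumFields.BalabanUV.T4Continuum.HistoryBankingVolumePlug
open Summit.QuantumFields.BalabanUV.T4Continuum.HistoryBankingForestPlug

namespace Summit.QuantumFields.BalabanUV.T4Continuum.B16HistoryWeightPlug

noncomputable section

-- the structural `DecidableEq` instance of the concrete tag type `Lab (ℕ × Lab d) (Lab d)` exceeds the default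
-- synthesis size (`synthInstance.maxSize` 128 — a classical fallback would not match the generic lemmas' instances)
set_option synthInstance.maxSize 1024

/-! ## §1 The event products of the live and of the died components, `pedM` ↦ `pedMV` -/

section Bridges

variable {d : ℕ} {J : RunInputM d} {M : Type*} [CommMonoid M]

/-- **LIVE EVENT PRODUCTS ARE UNCHANGED BY THE DISSOLUTION**, pedigree form:
`∏_{c ∈ histV.comp j} evProd (pedMV.toPGen id (j, c)) = ∏_{c ∈ histM.comp j} evProd (pedM.toPGen id (j, c))`. [folklore] -/
theorem prod_comp_evProd_pedMV (hN : J.NewOK) (hRm : ∀ t k, J.Rm t k ≤ J.R t)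
    (hRmS : ∀ t k, J.Rm t (k + 1) ≤ J.R (t + 1)) (hRm2 : ∀ t, 2 ≤ J.Rm t 1) (hD : J.NewDisjoint) (hL : 0 < J.L)
    (fB : ℕ → ℕ → Lab d → M) (fR : ℕ → M) (j : ℕ) :
    ∏ c ∈ J.histV.comp j, evProd fB fR (J.pedMV.toPGen id (j, c)) =
      ∏ c ∈ J.histM.comp j, evProd fB fR (J.pedM.toPGen id (j, c)) := by
  rw [Finset.prod_congr rfl fun c hc => RunInputM.evProd_pedMV_eq_pgenR hN hRm hRmS hRm2 hD hL fB fR hc,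
    Finset.prod_congr rfl fun c hc => RunInputM.evProd_pedM_eq_pgenR J hN hRm fB fR hc]
  exact ComponentHistory.prod_comp_dissolve_evProd fB fR (J.wf_histM hN)
    (ComponentHistory.spliceOK_of_splGood (RunInputM.splGood_splV hN hRm hL)) (RunInputM.labelOK_histM hN hD)
    (RunInputM.fresh_rnwM hN) (fun _ _ hn => RunInputM.rnwM_pseudo hN hD hn) j

/-- **DEAD EVENT PRODUCTS ARE UNCHANGED BY THE DISSOLUTION**, pedigree form:
`∏_{c ∈ histV.died j} evProd (pedMV.toPGen id (j, c)) = ∏_{c ∈ histM.died j} evProd (pedM.toPGen id (j, c))`. [folklore] -/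
theorem prod_died_evProd_pedMV (hN : J.NewOK) (hRm : ∀ t k, J.Rm t k ≤ J.R t)
    (hRmS : ∀ t k, J.Rm t (k + 1) ≤ J.R (t + 1)) (hRm2 : ∀ t, 2 ≤ J.Rm t 1) (hD : J.NewDisjoint) (hL : 0 < J.L)
    (fB : ℕ → ℕ → Lab d → M) (fR : ℕ → M) (j : ℕ) :
    ∏ c ∈ J.histV.died j, evProd fB fR (J.pedMV.toPGen id (j, c)) =
      ∏ c ∈ J.histM.died j, evProd fB fR (J.pedM.toPGen id (j, c)) := by
  rw [Finset.prod_congr rfl fun c hc =>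
      RunInputM.evProd_pedMV_eq_pgenR hN hRm hRmS hRm2 hD hL fB fR (J.histV.died_subset j hc),
    Finset.prod_congr rfl fun c hc => RunInputM.evProd_pedM_eq_pgenR J hN hRm fB fR (J.histM.died_subset j hc)]
  exact ComponentHistory.prod_died_dissolve_evProd fB fR (J.wf_histM hN)
    (ComponentHistory.spliceOK_of_splGood (RunInputM.splGood_splV hN hRm hL)) (RunInputM.labelOK_histM hN hD)
    (RunInputM.fresh_rnwM hN) (fun _ _ hn => RunInputM.rnwM_pseudo hN hD hn) j

end Bridges

/-! ## §2 The weight of a term: live members in the booked-cost currency, dead genealogies symbolic -/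

section Weight

variable {DomK : ℕ → Type*} {I : (K : ℕ) → HIndex (DomK K)} {d : ℕ} {X : ℕ → Type*}
  {𝒢 : (K : ℕ) → GoodClass (X K)}

/-- **THE WEIGHT OF A TERM IN THE END's CURRENCY** (M2 brick B × M5-2b∕c).  Under the displayed identification `HistRead`,
the pass-V process conditions of the run `J := runOf K a (h, ℓ, c)` read off the term (`NewOK`, memory domination and its
one-step form, non-degenerate memory, disjoint new regions, `0 < L`), the banking side conditions (`4 ≤ L` with drop
control, sizes `≥ 1`, `13 ≤ n₁`, `E₂, E₃ ≥ 0`) and the calibrated volume displays for the per-cube costs `Λ K` of the run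
(`u = log ∘ Λ K`: growth `L_u` over the lag `j ≥ 1`, `1122^d·16·21^d·L_u ≤ 2^j∕2`, `u_t·6(561^d j L_u + 1122^d L_u) ≤ floorK`,
`u·15·126^d ≤ E₂R^{q′}`, `u·24·126^d ≤ E₃R^{q′}`), for `K₀ ≤ K`, `|t| ≤ l₀` and `(h, ℓ, c) ∈ LIdx a`:
`weight μ Rp t ⟨K, a, (h, ℓ, c)⟩ ≤ LIVE · DEAD · rest` with
`LIVE = ∏_{x ∈ histV.comp K} e^{lifeCost (dictWT Prod.fst J.R C.n₁) (costT Prod.fst C K J.R) (pedMV.genT (K, x))} ·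
e^{birthWT Prod.fst (2^{d+3}·log Λ K) (pedMV.genT (K, x))} · evProd (fB K) (fR K) (pedMV.toPGen id (K, x))` and
`DEAD = ∏_{j < K} ∏_{x ∈ histV.died j} e^{treeVol id pedMV (log Λ K) j (j, x)} · evProd (fB K) (fR K) (pedMV.toPGen id (j, x))`.
[folklore] -/
theorem weight_le_live_mul_dead [∀ K, MeasurableSpace (X K)] (ℛ : HistReading I d) (Φf : HistFactors I d)
    (μ : (K : ℕ) → Measure (X K)) [∀ K, IsFiniteMeasure (μ K)] (Rp : (K : ℕ) → ℝ → Repr172R (𝒢 K) (I K))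
    {l₀ : ℝ} {K₀ : ℕ} (hR : HistRead ℛ Φf Rp l₀ K₀) {K : ℕ} (hK : K₀ ≤ K) {t : ℝ} (ht : |t| ≤ l₀)
    (a : (I K).Adm) {h : (I K).HZ} {l : (I K).HL} {c : (I K).HC} (hι : (h, l, c) ∈ (I K).LIdx a)
    (hN : (ℛ.runOf K a (h, l, c)).NewOK)
    (hRm : ∀ t k, (ℛ.runOf K a (h, l, c)).Rm t k ≤ (ℛ.runOf K a (h, l, c)).R t)
    (hRmS : ∀ t k, (ℛ.runOf K a (h, l, c)).Rm t (k + 1) ≤ (ℛ.runOf K a (h, l, c)).R (t + 1))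
    (hRm2 : ∀ t, 2 ≤ (ℛ.runOf K a (h, l, c)).Rm t 1) (hD : (ℛ.runOf K a (h, l, c)).NewDisjoint)
    (hL0 : 0 < (ℛ.runOf K a (h, l, c)).L) (hL4 : 4 ≤ (ℛ.runOf K a (h, l, c)).L)
    (hdrop : ∀ m, DropCtl (ℛ.runOf K a (h, l, c)).s m) (hR1 : ∀ t, 1 ≤ (ℛ.runOf K a (h, l, c)).R t)
    {C : T4PrintedShapeBanking.Consts} (hn₁ : 13 ≤ C.n₁) (hE₂ : 0 ≤ C.E₂) (hE₃ : 0 ≤ C.E₃) {Lu : ℝ} (hLu0 : 0 < Lu)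
    {j : ℕ} (hj1 : 1 ≤ j) (hLu : ∀ t i, i ≤ j → Real.log (Φf.Λ K (t + i)) ≤ Lu * Real.log (Φf.Λ K t))
    (hsmall : (1122 : ℝ) ^ d * 16 * 21 ^ d * Lu ≤ 2 ^ j / 2)
    (huΦ : ∀ t, t ≤ K →
      Real.log (Φf.Λ K t) * (6 * (561 ^ d * j * Lu + 1122 ^ d * Lu)) ≤ floorK C K (ℛ.runOf K a (h, l, c)).R t)
    (huE₂ : ∀ n, n ≤ K → Real.log (Φf.Λ K n) * (15 * 126 ^ d) ≤ C.E₂ * ((ℛ.runOf K a (h, l, c)).R n : ℝ) ^ C.q')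
    (huE₃ : ∀ n, n ≤ K → Real.log (Φf.Λ K n) * (24 * 126 ^ d) ≤ C.E₃ * ((ℛ.runOf K a (h, l, c)).R n : ℝ) ^ C.q') :
    Repr172R.weight μ Rp t ⟨K, a, (h, l, c)⟩ ≤
      (∏ x ∈ (ℛ.runOf K a (h, l, c)).histV.comp K,
          Real.exp (lifeCost (dictWT Prod.fst (ℛ.runOf K a (h, l, c)).R C.n₁)
              (costT Prod.fst C K (ℛ.runOf K a (h, l, c)).R) ((ℛ.runOf K a (h, l, c)).pedMV.genT (K, x))) *
            Real.exp (birthWT Prod.fst (fun n => 2 ^ (d + 3) * Real.log (Φf.Λ K n))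
              ((ℛ.runOf K a (h, l, c)).pedMV.genT (K, x))) *
            evProd (Φf.fB K) (Φf.fR K) ((ℛ.runOf K a (h, l, c)).pedMV.toPGen id (K, x))) *
        (∏ j ∈ Finset.range K, ∏ x ∈ (ℛ.runOf K a (h, l, c)).histV.died j,
          Real.exp (treeVol (ℛ.runOf K a (h, l, c)).L (ℛ.runOf K a (h, l, c)).s (fun v => (v : ℝ))
              (ℛ.runOf K a (h, l, c)).pedMV (fun j => Real.log (Φf.Λ K j)) j (j, x)) *
            evProd (Φf.fB K) (Φf.fR K) ((ℛ.runOf K a (h, l, c)).pedMV.toPGen id (j, x))) *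
        (Real.exp (Φf.BA K t) * (Φf.wC K t a c * Real.exp (Φf.BV K t a h l c)) * (μ K).real Set.univ) := by
  set J := ℛ.runOf K a (h, l, c) with hJ
  have hmem : h ∈ (I K).HZs a ∧ l ∈ (I K).HYs a ∧ c ∈ (I K).HCs a := by
    simpa [HIndex.LIdx, Finset.mem_product] using hι
  have hF := hR.forest_le K t ht hK a (h, l, c) hι
  -- U1 per elementary term (M1) with the displayed envelopes, then the identification (as in M2 brick B)
  have hBx : ∀ x, |(Rp K t).eterm a (h, l, c) x| ≤
      (∏ j ∈ Finset.range (K + 1), ∏ c' ∈ J.histM.comp j, Φf.levelFactor J.histM J.rnwM K j c') *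
        (Real.exp (Φf.BA K t) * (Φf.wC K t a c * Real.exp (Φf.BV K t a h l c))) := by
    intro x
    have hwC : 0 ≤ Φf.wC K t a c := (((Rp K t).TC a c).one_nonneg x).trans (hR.tc_le K t ht hK a c hmem.2.2 x)
    have hE : 0 ≤ Real.exp (Φf.BA K t) * (Φf.wC K t a c * Real.exp (Φf.BV K t a h l c)) :=
      mul_nonneg (Real.exp_pos _).le (mul_nonneg hwC (Real.exp_pos _).le)
    calc |(Rp K t).eterm a (h, l, c) x|
        ≤ Φf.wZ K t a h * (Real.exp (Φf.BA K t) * (Φf.wY K t a l * (Φf.wC K t a c * Real.exp (Φf.BV K t a h l c)))) :=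
          (Rp K t).abs_eterm_le a (h, l, c) (fun V => hR.χ01 K t a V) (fun W => hR.tz_le K t ht hK a h hmem.1 W)
            (fun W => hR.ty_le K t ht hK a l hmem.2.1 W) (fun W => hR.tc_le K t ht hK a c hmem.2.2 W)
            (hR.A'_le K t ht hK) (fun W => hR.Vs_le K t ht hK a h l c W) x
      _ = Φf.wZ K t a h * Φf.wY K t a l *
            (Real.exp (Φf.BA K t) * (Φf.wC K t a c * Real.exp (Φf.BV K t a h l c))) := by ring
      _ ≤ _ := mul_le_mul_of_nonneg_right hF hE
  -- U1 integrated (M2-A): `|weight| ≤ (∏ levelFactor) · E · mass`, hence the right-hand side is NONNEGATIVE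
  have hw := Repr172R.abs_weight_le μ Rp t K a (h, l, c) hBx
  have hP := Φf.prod_levelFactor_eq_pedM J hN hRm K
  -- abbreviations
  set VOLM := ∏ j ∈ Finset.range (K + 1), ∏ c' ∈ J.histM.comp j, Φf.Λ K j ^ (c'.2).card with hVOLM
  set EVM := (∏ c' ∈ J.histM.comp K, evProd (Φf.fB K) (Φf.fR K) (J.pedM.toPGen id (K, c'))) *
    ∏ j ∈ Finset.range K, ∏ c' ∈ J.histM.died j, evProd (Φf.fB K) (Φf.fR K) (J.pedM.toPGen id (j, c')) with hEVM
  set E := Real.exp (Φf.BA K t) * (Φf.wC K t a c * Real.exp (Φf.BV K t a h l c)) * (μ K).real Set.univ with hE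
  have hVpos : 0 < VOLM :=
    Finset.prod_pos fun j _ => Finset.prod_pos fun c' _ => lt_of_lt_of_le zero_lt_one (Φf.one_le_Λ_pow K j _)
  -- `weight ≤ VOLM · EVM · E` and `0 ≤ VOLM · EVM · E`
  have h1 : Repr172R.weight μ Rp t ⟨K, a, (h, l, c)⟩ ≤ VOLM * EVM * E := by
    have := (le_abs_self _).trans hw
    rw [hP] at this
    calc _ ≤ _ := this
      _ = _ := by rw [hE]; ring
  have h0 : 0 ≤ VOLM * EVM * E := by
    have := (abs_nonneg _).trans hw
    rw [hP] at this
    calc (0 : ℝ) ≤ _ := this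
      _ = _ := by rw [hE]; ring
  have hEE : 0 ≤ EVM * E := by
    have h' : 0 ≤ VOLM * (EVM * E) := by rw [← mul_assoc]; exact h0
    exact (mul_nonneg_iff_of_pos_left hVpos).1 h'
  -- the volume factor along the pass-V forest; the event products moved to `pedMV`
  have hV := prod_pow_card_le_live_mul_dead (I := J) (C := C) hN hRm hRmS hRm2 hD hL0 hL4 hdrop hR1 hn₁ hE₂ hE₃
    (Λ := Φf.Λ K) (fun j => Φf.one_le_Λ K j) hLu0 hj1 hLu hsmall huΦ huE₂ huE₃
  have hlive := prod_comp_evProd_pedMV hN hRm hRmS hRm2 hD hL0 (Φf.fB K) (Φf.fR K) K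
  have hdead : ∏ j ∈ Finset.range K, ∏ x ∈ J.histV.died j, evProd (Φf.fB K) (Φf.fR K) (J.pedMV.toPGen id (j, x)) =
      ∏ j ∈ Finset.range K, ∏ x ∈ J.histM.died j, evProd (Φf.fB K) (Φf.fR K) (J.pedM.toPGen id (j, x)) :=
    Finset.prod_congr rfl fun j _ => prod_died_evProd_pedMV hN hRm hRmS hRm2 hD hL0 (Φf.fB K) (Φf.fR K) j
  have h2 : VOLM * EVM * E ≤
      ((∏ x ∈ J.histV.comp K,
          Real.exp (lifeCost (dictWT Prod.fst J.R C.n₁) (costT Prod.fst C K J.R) (J.pedMV.genT (K, x))) *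
            Real.exp (birthWT Prod.fst (fun n => 2 ^ (d + 3) * Real.log (Φf.Λ K n)) (J.pedMV.genT (K, x)))) *
        ∏ j ∈ Finset.range K, ∏ x ∈ J.histV.died j,
          Real.exp (treeVol J.L J.s (fun v => (v : ℝ)) J.pedMV (fun j => Real.log (Φf.Λ K j)) j (j, x))) *
        EVM * E := by
    rw [mul_assoc, mul_assoc _ EVM E]
    exact mul_le_mul_of_nonneg_right hV hEE
  have eq1 : (∏ x ∈ J.histV.comp K,
      Real.exp (lifeCost (dictWT Prod.fst J.R C.n₁) (costT Prod.fst C K J.R) (J.pedMV.genT (K, x))) *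
        Real.exp (birthWT Prod.fst (fun n => 2 ^ (d + 3) * Real.log (Φf.Λ K n)) (J.pedMV.genT (K, x))) *
        evProd (Φf.fB K) (Φf.fR K) (J.pedMV.toPGen id (K, x))) =
      (∏ x ∈ J.histV.comp K,
        Real.exp (lifeCost (dictWT Prod.fst J.R C.n₁) (costT Prod.fst C K J.R) (J.pedMV.genT (K, x))) *
          Real.exp (birthWT Prod.fst (fun n => 2 ^ (d + 3) * Real.log (Φf.Λ K n)) (J.pedMV.genT (K, x)))) *
        ∏ x ∈ J.histV.comp K, evProd (Φf.fB K) (Φf.fR K) (J.pedMV.toPGen id (K, x)) :=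
    Finset.prod_mul_distrib
  have eq2 : (∏ j ∈ Finset.range K, ∏ x ∈ J.histV.died j,
      Real.exp (treeVol J.L J.s (fun v => (v : ℝ)) J.pedMV (fun j => Real.log (Φf.Λ K j)) j (j, x)) *
        evProd (Φf.fB K) (Φf.fR K) (J.pedMV.toPGen id (j, x))) =
      (∏ j ∈ Finset.range K, ∏ x ∈ J.histV.died j,
        Real.exp (treeVol J.L J.s (fun v => (v : ℝ)) J.pedMV (fun j => Real.log (Φf.Λ K j)) j (j, x))) *
        ∏ j ∈ Finset.range K, ∏ x ∈ J.histV.died j, evProd (Φf.fB K) (Φf.fR K) (J.pedMV.toPGen id (j, x)) := by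
    rw [← Finset.prod_mul_distrib]
    exact Finset.prod_congr rfl fun j _ => Finset.prod_mul_distrib
  refine h1.trans (h2.trans (le_of_eq ?_))
  rw [eq1, eq2, hEVM, ← hlive, ← hdead]
  ring

end Weight

end

end Summit.QuantumFields.BalabanUV.T4Continuum.B16HistoryWeightPlug
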